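import Summits.CriticalPhenomena.PercolationContinuityZ3.Theorems.PercNearOneGluingNoHeavyLowerTailCousinCex

/-!
# `NoHeavyLowerTail` (stmt-CriticalPhenomena-4575) — the FULL-MENU per-relay ratio step "MONO-ρ" with the sharp loss
# `|A|/(|A|−1)` is FALSE at the ladder cell `(|A|, j) = (7, 3)`: checker, move algebra and kernel arithmetic

Prover `prim-lf-5` (lemma factory #5, blob-quotient / deletion induction on `|A|`), `--supports stmt-CriticalPhenomena-4575`.
No named facts, no sorries; the `def`s are computable checkers, list surgery and witness data only (pattern of
`…MLnaCexChecker.lean`, `…MonoRhoDSCex.lean`).  The deliverable `not_monoRho_7_3` is in `…MonoRhoCex.lean`.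

MONO-ρ (crux evidence LF5-CANDIDATES.md §A5, census request `lf5-mono-rho`; notation `μ = prodBernoulli w`, relays `A`,
`|A| = k`, observer `o`, level `j`, `bad_j(B) = μ{1 ≤ |C(o) ∩ B| ≤ j}`, `I_j(B; a) = μ{|C(a) ∩ B| ≤ j}`,
`r = bad_j(A) / max_a I_j(A; a)`): for every instance on the LADDER `j + 3 ≤ k ≤ 2j + 1` some SINGLE-RELAY MOVE — `DS(y)`:
`y` leaves `A`, graph unchanged; `W(y)`: the vertex `y` is deleted (all its pairs get weight `0`); `Q(x,y)`, `x ∈ A ∖ y`: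
the pair `xy` is glued (weight `1`) and `y` leaves `A` — loses at most the factor `(k−1)/k` in `r`.  The losses would
telescope to the constant `2` and close the crux (`…MonoRhoReduction.lean`).  The relay-deletion-only form is refuted at
`(6, 3)` in `…MonoRhoDSCex.lean`; the ttrl2 census (`run/shared/lean/ttrl/monorho/README.md`, RESULT 05:30Z + addendum)
refuted the full menu at `(7, 3)` on the family "three glued pairs + one singleton in a ring, observer on the singleton".
This file certifies a clean eight-edge member of that family in the kernel.

WITNESS (`wit73`, `n = 8`, observer `0`, relays `A = {1,…,7}`, level `j = 3`): glued pairs `12, 34, 56` (weight `1`),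
pair links `23, 45` (weight `4/5`), singleton `7` with links `67, 17` (weight `11/12`), observer edge `07` (weight `1/10`).
Exact values: `bad_3(A) = 3/800`; `I_3(A; ·) = 23/720, 23/720, 1/25, 1/25, 23/720, 23/720, 3/80` (champions `3, 4`),
`r = 3/32`.  The best of the `42 + 7 + 7` moves is `DS(7)` (`bad' = 11/3600`, `max I' = 1/25`, `r' = 11/144`), so the
loss factor is `Λ_r = r / max r' = 27/22 = 1.2272… > 7/6` (normalised `1.0519`); runner-up `W(1)`, `W(6)` (`r' = 2/27`).

Contents: `Fin 8` reach-count tests and exact counts (`nrel`, `badB`, `lightB`, `cntBad`, `cntLight`) with the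
evaluation lemmas `real_bad`, `real_light` (via `WorstPairExchangeCex.real_eq_wcount`); the list surgery of the two
graph-changing moves — `delV` (vertex deletion, `wOfList_delV`) and `glueE` (gluing a pair, `update_wOfList_one`;
cf. `CousinCex.update_wOfList_cons_one` for the first listed pair), both for arbitrary `n` and arbitrary weighted edge lists; the witness; and the ARITHMETIC by kernel reduction
(`decide +kernel`, standard axioms) of the two shared values `wit73_bad` (`bad_3(A) = 3/800`) and `champion`
(`I_3(A; a) ≤ 1/25` for all `a`).  The 56 move facts and the deliverable are in `…MonoRhoCex.lean`.  To keep the kernel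
work small the counts enumerate only the non-deterministic pairs (`wsubsP` / `wtabsP`: a weight-`1` pair is always open,
a weight-`0` pair never; `sum_ind_wsubsP` proves this pruning exact against `wsubs`), so the witness costs `2⁵`
configurations per count instead of `2⁸`.  Exact brute force and reproduction: `run/shared/lean/prim/prim-lf-5/code/mr73.py`.
-/

namespace Summit.CriticalPhenomena.PercolationContinuityZ3.Theorems

open MeasureTheory
open Literature.Probability.LatticeModels Literature.Probability.Percolation
open Summit.CriticalPhenomena.PercolationContinuityZ3.Theorems.AdditiveGluing.Negative.Cert

namespace MonoRhoCex

/-! ### List surgery for the two graph-changing moves (any `n`, any weighted edge list) -/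

/-- Vertex deletion `W(y)` on a weighted edge list: every listed pair containing `y` gets weight `0`. -/
def delV {n : ℕ} (y : Fin n) (l : List (Fin n × Fin n × ℚ)) : List (Fin n × Fin n × ℚ) :=
  l.map fun t => (t.1, t.2.1, if y = t.1 ∨ y = t.2.1 then 0 else t.2.2)

/-- Gluing `Q(x,y)` on a weighted edge list: the pair `xy` gets weight `1` (re-weighted if listed, prepended if not). -/
def glueE {n : ℕ} (x y : Fin n) (l : List (Fin n × Fin n × ℚ)) : List (Fin n × Fin n × ℚ) :=
  if s(x, y) ∈ wPairs l then l.map fun t => (t.1, t.2.1, if mkE (t.1, t.2.1) = s(x, y) then 1 else t.2.2)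
  else (x, y, 1) :: l

/-- `delV` does not change the listed pairs. [this file] -/
theorem wPairs_delV {n : ℕ} (y : Fin n) (l : List (Fin n × Fin n × ℚ)) : wPairs (delV y l) = wPairs l := by
  simp [wPairs, delV]

/-- `delV` keeps the weights in `[0, 1]`. [this file] -/
theorem delV_weights {n : ℕ} (y : Fin n) (l : List (Fin n × Fin n × ℚ)) (hq : ∀ e ∈ l, 0 ≤ e.2.2 ∧ e.2.2 ≤ 1) :
    ∀ e ∈ delV y l, 0 ≤ e.2.2 ∧ e.2.2 ≤ 1 := by
  intro e he
  simp only [delV, List.mem_map] at he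
  obtain ⟨t, ht, rfl⟩ := he
  dsimp only
  split_ifs
  · exact ⟨le_rfl, zero_le_one⟩
  · exact hq t ht

/-- Pointwise: the weight function of `delV y l` is that of `l` with the pairs containing `y` set to `0`. [this file] -/
theorem wOfList_delV_apply {n : ℕ} (y : Fin n) :
    ∀ (l : List (Fin n × Fin n × ℚ)) (x : Sym2 (Fin n)), wOfList (delV y l) x = if y ∈ x then 0 else wOfList l x
  | [], x => by simp [delV, wOfList]
  | e :: l, x => by
    have ih := wOfList_delV_apply y l x
    simp only [delV, List.map_cons] at ih ⊢
    simp only [wOfList]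
    by_cases hx : x = mkE (e.1, e.2.1)
    · rw [if_pos hx, if_pos hx]
      have hmem : y ∈ x ↔ y = e.1 ∨ y = e.2.1 := by rw [hx]; exact Sym2.mem_iff
      by_cases hy : y = e.1 ∨ y = e.2.1
      · rw [if_pos hy, if_pos (hmem.2 hy)]
        ext
        simp [Set.projIcc]
      · rw [if_neg hy, if_neg (fun h => hy (hmem.1 h))]
    · rw [if_neg hx, if_neg hx]
      exact ih

/-- **`W(y)` as a weighted edge list**: `(e ↦ if y ∈ e then 0 else w e) = wOfList (delV y l)` for `w = wOfList l`.
[this file] -/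
theorem wOfList_delV {n : ℕ} (y : Fin n) (l : List (Fin n × Fin n × ℚ)) :
    (fun e : Sym2 (Fin n) => if y ∈ e then (0 : unitInterval) else wOfList l e) = wOfList (delV y l) := by
  funext x
  exact (wOfList_delV_apply y l x).symm

/-- Pointwise: re-weighting the listed pair `p` to `1` changes the weight function exactly at `p`, and only if `p` is
listed. [this file] -/
theorem wOfList_setOne_apply {n : ℕ} (p : Sym2 (Fin n)) :
    ∀ (l : List (Fin n × Fin n × ℚ)) (z : Sym2 (Fin n)),
      wOfList (l.map fun t => (t.1, t.2.1, if mkE (t.1, t.2.1) = p then 1 else t.2.2)) z =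
        if z = p ∧ p ∈ wPairs l then 1 else wOfList l z
  | [], z => by simp [wPairs, wOfList]
  | e :: l, z => by
    have ih := wOfList_setOne_apply p l z
    have hcons : p ∈ wPairs (e :: l) ↔ p = mkE (e.1, e.2.1) ∨ p ∈ wPairs l := by
      simp only [wPairs, List.map_cons, List.mem_cons]
    simp only [List.map_cons, wOfList]
    by_cases hz : z = mkE (e.1, e.2.1)
    · rw [if_pos hz, if_pos hz]
      by_cases hep : mkE (e.1, e.2.1) = p
      · rw [if_pos hep, if_pos ⟨hz.trans hep, hcons.2 (Or.inl hep.symm)⟩]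
        ext
        simp [Set.projIcc]
      · rw [if_neg hep, if_neg (fun h => hep (hz.symm.trans h.1))]
    · rw [if_neg hz, if_neg hz, ih]
      by_cases hzp : z = p ∧ p ∈ wPairs l
      · rw [if_pos hzp, if_pos ⟨hzp.1, hcons.2 (Or.inr hzp.2)⟩]
      · rw [if_neg hzp]
        by_cases h' : z = p ∧ p ∈ wPairs (e :: l)
        · exfalso
          rcases hcons.1 h'.2 with h | h
          · exact hz (h'.1.trans h)
          · exact hzp ⟨h'.1, h⟩
        · rw [if_neg h']

/-- **`Q(x,y)` as a weighted edge list**: `w[s(x,y) ↦ 1] = wOfList (glueE x y l)` for `w = wOfList l`. [this file] -/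
theorem update_wOfList_one {n : ℕ} (x y : Fin n) (l : List (Fin n × Fin n × ℚ)) :
    Function.update (wOfList l) s(x, y) 1 = wOfList (glueE x y l) := by
  funext z
  unfold glueE
  split_ifs with hmem
  · rw [wOfList_setOne_apply]
    by_cases hz : z = s(x, y)
    · subst hz
      rw [Function.update_self, if_pos ⟨rfl, hmem⟩]
    · rw [Function.update_of_ne hz, if_neg (fun h => hz h.1)]
  · by_cases hz : z = s(x, y)
    · subst hz
      rw [Function.update_self]
      have h1 : wOfList ((x, y, (1 : ℚ)) :: l) s(x, y) = Set.projIcc (0 : ℝ) 1 zero_le_one ((1 : ℚ) : ℝ) := by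
        simp [wOfList, mkE]
      rw [h1, CousinCex.projIcc_ratCast_one]
    · rw [Function.update_of_ne hz]
      have h1 : wOfList ((x, y, (1 : ℚ)) :: l) z = wOfList l z := by
        simp [wOfList, mkE, hz]
      rw [h1]

/-- `glueE` keeps the listed pairs distinct. [this file] -/
theorem glueE_nodup {n : ℕ} (x y : Fin n) (l : List (Fin n × Fin n × ℚ)) (h : (wPairs l).Nodup) :
    (wPairs (glueE x y l)).Nodup := by
  unfold glueE
  split_ifs with hmem
  · have hc : wPairs (l.map fun t => (t.1, t.2.1, if mkE (t.1, t.2.1) = s(x, y) then (1 : ℚ) else t.2.2)) = wPairs l := by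
      simp [wPairs, Function.comp_def]
    rw [hc]
    exact h
  · have hc : wPairs ((x, y, (1 : ℚ)) :: l) = mkE (x, y) :: wPairs l := rfl
    rw [hc, List.nodup_cons]
    exact ⟨hmem, h⟩

/-- `glueE` keeps the weights in `[0, 1]`. [this file] -/
theorem glueE_weights {n : ℕ} (x y : Fin n) (l : List (Fin n × Fin n × ℚ)) (hq : ∀ e ∈ l, 0 ≤ e.2.2 ∧ e.2.2 ≤ 1) :
    ∀ e ∈ glueE x y l, 0 ≤ e.2.2 ∧ e.2.2 ≤ 1 := by
  unfold glueE
  split_ifs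
  · intro e he
    simp only [List.mem_map] at he
    obtain ⟨t, ht, rfl⟩ := he
    dsimp only
    split_ifs
    · exact ⟨zero_le_one, le_rfl⟩
    · exact hq t ht
  · intro e he
    rcases List.mem_cons.1 he with rfl | he
    · exact ⟨zero_le_one, le_rfl⟩
    · exact hq e he

/-! ### Pruned enumeration: deterministic pairs (weight `0` or `1`) are not branched on -/

/-- The sub-configurations of a weighted edge list with their weights, SKIPPING the zero-weight branches: a pair of
weight `1` is always kept, a pair of weight `0` never (cf. `wsubs`, which branches on every listed pair). -/
def wsubsP {n : ℕ} : List (Fin n × Fin n × ℚ) → List (List (Fin n × Fin n) × ℚ)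
  | [] => [([], 1)]
  | e :: l =>
    (if e.2.2 = 1 then [] else (wsubsP l).map fun c => (c.1, c.2 * (1 - e.2.2))) ++
      (if e.2.2 = 0 then [] else (wsubsP l).map fun c => ((e.1, e.2.1) :: c.1, c.2 * e.2.2))

/-- Reach tables of the pruned sub-configurations. -/
def wtabsP (n : ℕ) (l : List (Fin n × Fin n × ℚ)) : List (List ℕ × ℚ) :=
  (wsubsP l).map fun c => (reachTable n c.1, c.2)

/-- Scaling a weighted indicator sum (closed branch). [this file] -/
theorem sum_ind_scale_closed {α : Type*} (L : List (α × ℚ)) (g : α → Bool) (r : ℚ) :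
    ((L.map fun c => (c.1, c.2 * r)).map fun c => if g c.1 then c.2 else 0).sum =
      ((L.map fun c => if g c.1 then c.2 else 0).sum) * r := by
  rw [List.map_map, ← List.sum_map_mul_right]
  congr 1
  refine List.map_congr_left fun c _ => ?_
  simp only [Function.comp_apply]
  split_ifs <;> simp

/-- Scaling a weighted indicator sum (open branch: the pair `e` is prepended to every configuration). [this file] -/
theorem sum_ind_scale_open {α : Type*} (L : List (List α × ℚ)) (g : List α → Bool) (e : α) (r : ℚ) :
    ((L.map fun c => (e :: c.1, c.2 * r)).map fun c => if g c.1 then c.2 else 0).sum =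
      ((L.map fun c => if g (e :: c.1) then c.2 else 0).sum) * r := by
  rw [List.map_map, ← List.sum_map_mul_right]
  congr 1
  refine List.map_congr_left fun c _ => ?_
  simp only [Function.comp_apply]
  split_ifs <;> simp

/-- **Pruning is exact**: the weighted indicator sums over `wsubsP l` and over `wsubs l` agree (the skipped branches
have weight `0`). [this file] -/
theorem sum_ind_wsubsP {n : ℕ} : ∀ (l : List (Fin n × Fin n × ℚ)) (g : List (Fin n × Fin n) → Bool),
    ((wsubsP l).map fun c => if g c.1 then c.2 else 0).sum = ((wsubs l).map fun c => if g c.1 then c.2 else 0).sum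
  | [], _ => rfl
  | e :: l, g => by
    have ihc := sum_ind_wsubsP l g
    have iho := sum_ind_wsubsP l (fun c => g ((e.1, e.2.1) :: c))
    have hc := sum_ind_scale_closed (wsubs l) g (1 - e.2.2)
    have ho := sum_ind_scale_open (wsubs l) g (e.1, e.2.1) e.2.2
    have hcP := sum_ind_scale_closed (wsubsP l) g (1 - e.2.2)
    have hoP := sum_ind_scale_open (wsubsP l) g (e.1, e.2.1) e.2.2
    rw [ihc] at hcP
    rw [iho] at hoP
    simp only [wsubsP, wsubs, List.map_append, List.sum_append]
    rw [hc, ho]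
    by_cases h1 : e.2.2 = 1
    · have h0 : ¬ e.2.2 = 0 := by rw [h1]; norm_num
      rw [if_pos h1, if_neg h0, hoP, List.map_nil, List.sum_nil, h1]
      ring
    · by_cases h0 : e.2.2 = 0
      · rw [if_neg h1, if_pos h0, hcP, List.map_nil, List.sum_nil, h0]
        ring
      · rw [if_neg h1, if_neg h0, hcP, hoP]

/-- Pruned and full weighted counts of a reach-table test agree. [this file] -/
theorem sum_wtabsP (n : ℕ) (l : List (Fin n × Fin n × ℚ)) (f : List ℕ → Bool) :
    ((wtabsP n l).map fun t => if f t.1 then t.2 else 0).sum =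
      ((wtabs n l).map fun t => if f t.1 then t.2 else 0).sum := by
  unfold wtabsP wtabs
  rw [List.map_map, List.map_map]
  exact sum_ind_wsubsP l (fun c => f (reachTable n c))

/-! ### The two events as `Bool` tests on reach tables (`Fin 8`, observer `0`, level `3`) -/

/-- Number of vertices of `B` reachable from `x` according to a reach table. -/
def nrel (B : Finset (Fin 8)) (tb : List ℕ) (x : Fin 8) : ℕ :=
  (B.filter fun z : Fin 8 => (tb.getD x.val 0).testBit z.val = true).card

/-- The observer `0` sees between `1` and `3` vertices of `B` ("bad" at level `3` for the relay set `B`). -/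
def badB (B : Finset (Fin 8)) (tb : List ℕ) : Bool := decide (1 ≤ nrel B tb 0 ∧ nrel B tb 0 ≤ 3)

/-- `a` sees at most `3` vertices of `B` ("light" at level `3` for the relay set `B`). -/
def lightB (B : Finset (Fin 8)) (a : Fin 8) (tb : List ℕ) : Bool := decide (nrel B tb a ≤ 3)

/-- Exact weighted count of `badB` (pruned enumeration). -/
def cntBad (l : List (Fin 8 × Fin 8 × ℚ)) (B : Finset (Fin 8)) : ℚ :=
  ((wtabsP 8 l).map fun t => if badB B t.1 then t.2 else 0).sum

/-- Exact weighted count of `lightB` (pruned enumeration). -/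
def cntLight (l : List (Fin 8 × Fin 8 × ℚ)) (B : Finset (Fin 8)) (a : Fin 8) : ℚ :=
  ((wtabsP 8 l).map fun t => if lightB B a t.1 then t.2 else 0).sum

open scoped Classical in
/-- Per-configuration agreement of the reach count. [this file] -/
theorem nrel_reachTable (ω : List (Fin 8 × Fin 8)) (B : Finset (Fin 8)) (x : Fin 8) :
    nrel B (reachTable 8 ω) x =
      (B.filter fun z => (↑(Eset ω) : Set (Sym2 (Fin 8))) ∈ openConn x z).card := by
  unfold nrel
  rw [Finset.filter_congr fun z _ => testBit_reachTable_iff_mem_openConn ω x z]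

open scoped Classical in
/-- `bad_3(B) = cntBad`. [this file] -/
theorem real_bad {l : List (Fin 8 × Fin 8 × ℚ)} (hnd : (wPairs l).Nodup)
    (hq : ∀ e ∈ l, 0 ≤ e.2.2 ∧ e.2.2 ≤ 1) (B : Finset (Fin 8)) :
    (prodBernoulli (wOfList l)).real
        {ω : BondConfig (Fin 8) |
          1 ≤ (B.filter fun x => ω ∈ openConn (0 : Fin 8) x).card ∧
            (B.filter fun x => ω ∈ openConn (0 : Fin 8) x).card ≤ 3} = (cntBad l B : ℝ) := by
  rw [cntBad, sum_wtabsP]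
  refine WorstPairExchangeCex.real_eq_wcount hnd hq (badB B) _ fun ω => ?_
  simp only [badB, decide_eq_true_eq, Set.mem_setOf_eq, nrel_reachTable]

open scoped Classical in
/-- `I_3(B; a) = cntLight`. [this file] -/
theorem real_light {l : List (Fin 8 × Fin 8 × ℚ)} (hnd : (wPairs l).Nodup)
    (hq : ∀ e ∈ l, 0 ≤ e.2.2 ∧ e.2.2 ≤ 1) (B : Finset (Fin 8)) (a : Fin 8) :
    (prodBernoulli (wOfList l)).real
        {ω : BondConfig (Fin 8) | (B.filter fun x => ω ∈ openConn a x).card ≤ 3} = (cntLight l B a : ℝ) := by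
  rw [cntLight, sum_wtabsP]
  refine WorstPairExchangeCex.real_eq_wcount hnd hq (lightB B a) _ fun ω => ?_
  simp only [lightB, decide_eq_true_eq, Set.mem_setOf_eq, nrel_reachTable]

/-- Exact counts are probabilities, hence nonnegative. [this file] -/
theorem cntBad_nonneg {l : List (Fin 8 × Fin 8 × ℚ)} (hnd : (wPairs l).Nodup)
    (hq : ∀ e ∈ l, 0 ≤ e.2.2 ∧ e.2.2 ≤ 1) (B : Finset (Fin 8)) : (0 : ℝ) ≤ (cntBad l B : ℝ) := by
  classical
  rw [← real_bad hnd hq B]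
  exact measureReal_nonneg

/-! ### The witness -/

/-- The witness: glued pairs `12, 34, 56`, pair links `23, 45` of weight `4/5`, singleton links `67, 17` of weight
`11/12`, observer edge `07` of weight `1/10`. -/
def wit73 : List (Fin 8 × Fin 8 × ℚ) :=
  [(1, 2, 1), (3, 4, 1), (5, 6, 1), (2, 3, 4/5), (4, 5, 4/5), (6, 7, 11/12), (1, 7, 11/12), (0, 7, 1/10)]

/-- The listed pairs are distinct. [this file] -/
theorem wit73_nodup : (wPairs wit73).Nodup := by decide

/-- The witness weights lie in `[0, 1]`. [this file] -/
theorem wit73_weights : ∀ e ∈ wit73, 0 ≤ e.2.2 ∧ e.2.2 ≤ 1 := by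
  intro e he
  simp only [wit73, List.mem_cons, List.not_mem_nil, or_false] at he
  rcases he with rfl | rfl | rfl | rfl | rfl | rfl | rfl | rfl <;> norm_num

/-- The relay set `{1,…,7}`. -/
def A7 : Finset (Fin 8) := {1, 2, 3, 4, 5, 6, 7}

/-- `A7.card = 7`. [this file] -/
theorem A7_card : A7.card = 7 := by decide

/-! ### The arithmetic (exact rational counts over `2⁸`–`2⁹` configurations, kernel reduction) -/

/-- `bad_3(A) = 3/800` at the witness. [this file] -/
theorem wit73_bad : cntBad wit73 A7 = 3/800 := by
  decide +kernel

/-- `max_a I_3(A; a) = 1/25` at the witness: every relay has `I_3(A; a) ≤ 1/25` (attained at `a = 3, 4`). [this file] -/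
theorem champion : ∀ a ∈ A7, cntLight wit73 A7 a ≤ 1/25 := by
  decide +kernel

end MonoRhoCex

end Summit.CriticalPhenomena.PercolationContinuityZ3.Theorems
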